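import Mathlib
import Summits.KontsevichZagierPeriods.Zeta5Search.Families.DexactDiagonal
import HarnessLib

/-!
# ζ(5) search — Families: Gauss congruences for the torus periods and for Zudilin's leading coefficients `Qₙ`

HONEST FRAMING: systematic search; no irrationality claim unless certified.  Cell `pub-zeta5`, family designer
fam-tele g13, 2026-08-22.  Congruences between integers; nothing about the arithmetic of `ζ(5)`; no record moves;
no conjecture node is used except, explicitly, as the hypothesis of the one theorem marked CONDITIONAL.

PRIOR ART (the mathematics is classical — kernel-certified here, not new): that the constant terms `CT[Λⁿ]` of
the powers of an integral Laurent polynomial satisfy the GAUSS CONGRUENCES `u(m pʳ) ≡ u(m pʳ⁻¹) (mod pʳ)` for every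
prime `p` and all `m ≥ 0, r ≥ 1` is "well-known" [cite: Liu2025, §2.2]; definitions and a survey of such congruences
in [cite: BeukersHoubenStraub2018, §1] (Acta Arith. 184 (2018); arXiv:1710.00423).  The supercongruence version
`mod p^{3r}`, `p ≥ 5`, is Beukers 1985 / Coster 1988 for the Apéry numbers and, for the leading coefficients `A_σ(n)`
of Brown's cellular integrals, CONJECTURE 1.3 of [cite: MccarthyOsburnStraub2018] (arXiv:1705.05586; tree node
`CellularVIMRecurrenceLaws.VIMSupercongruence` for the VIM plan) — NOT touched here.  OBSERVED outside the kernel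
(seat script, exact integers; NOT proved, NOT used): `Q(m pʳ) ≡ Q(m pʳ⁻¹) (mod p^{3r})` for all primes `5 ≤ p ≤ 59`,
`m pʳ ≤ 59`; in that range the largest exponent valid for all `m` is `3r` for `p = 2` and `3r − 1` for `p = 3`.

CONTENTS (standard axioms only):
* `GaussCT.coeff_smul_pow_gauss` — for ANY `L : MvPolynomial σ ℤ` and ANY exponent vector `d`, the coefficient
  sequence `u n = [x^{n·d}] Lⁿ` (= `CT[(L/x^d)ⁿ]`) satisfies `pʳ ∣ u(m pʳ) − u(m pʳ⁻¹)` for every prime `p` and all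
  `m, r` (Frobenius `Lᵖ ≡ L(xᵖ) (mod p)` = Mathlib's `MvPolynomial.expand_zmod`, lifted to `L^{pʳ} ≡ L(xᵖ)^{pʳ⁻¹}
  (mod pʳ)` by `dvd_sub_pow_of_dvd_sub`, then `MvPolynomial.coeff_expand_smul`);
* `dualConstantTerm_ray_gauss` — UNCONDITIONAL: along every ray `n ↦ n·a` of the Brown–Zudilin cone (`A, B ≥ 0`)
  the dual constant terms ("torus periods" `J(n·a)`, [cite: MccarthyOsburnStraub2018, §3.2]) satisfy the Gauss congruences;
* **`Q_gauss`** — UNCONDITIONAL: Zudilin's leading coefficients `Qₙ` of the totally symmetric `ζ(5)`-forms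
  ([BrownZudilin2022, eq. (7)]) satisfy `pʳ ∣ Q(m pʳ) − Q(m pʳ⁻¹)` for EVERY prime `p` and all `m, r` — by the tree's
  D-exact-on-the-diagonal theorem `DualCT.dualConstantTerm_diag_eq_Q` (`Families/DexactDiagonal`); in particular
  `Q p ≡ 21 (mod p)` (`Q_prime_sub_21`);
* `abs_QOf_ray_gauss_of_conjDexact` — CONDITIONAL on the conjecture node `LeadingCoeffIsDualConstantTerm`
  (D-exact, `Families/DualConstantTerm`): the same congruences for `n ↦ |Q(n·a)|` along every ray of the cone.
The generic lemma applies verbatim to any leading-coefficient sequence once it is identified with a coefficient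
sequence `[x^{n·d}] Lⁿ` (`GaussCT.gauss_of_eq_coeff_smul_pow`); for the VIM plan this would be the all-primes
`mod pʳ` floor under `VIMSupercongruence` — D-exact(VIM) is NOT in the tree beyond `n = 1`, so nothing is claimed.
-/

noncomputable section

open MvPolynomial Finset

namespace Summit.KontsevichZagierPeriods.Zeta5Search.Families.Cellular

open Literature.NumberTheory.Irrationality

/-! ## Generic: Gauss congruences for coefficient sequences `[x^{n·d}] Lⁿ` of an integral polynomial -/

namespace GaussCT

variable {σ : Type*}

/-- Frobenius over `𝔽ₚ`, lifted to `ℤ`: `p ∣ Lᵖ − L(xᵖ)` coefficientwise, i.e. `C p ∣ L ^ p − expand p L`. -/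
theorem C_dvd_pow_prime_sub_expand (L : MvPolynomial σ ℤ) {p : ℕ} (hp : p.Prime) :
    C (p : ℤ) ∣ L ^ p - expand p L := by
  haveI := Fact.mk hp
  rw [C_dvd_iff_zmod, map_sub, map_pow, map_expand, expand_zmod, sub_self]

/-- The lifted Frobenius congruence: `p^{k+1} ∣ L^{m p^{k+1}} − (L^{m p^k})(xᵖ)` in `MvPolynomial σ ℤ`. -/
theorem natCast_pow_dvd_pow_sub_expand_pow (L : MvPolynomial σ ℤ) {p : ℕ} (hp : p.Prime) (m k : ℕ) :
    ((p : MvPolynomial σ ℤ) ^ (k + 1)) ∣ L ^ (m * p ^ (k + 1)) - expand p (L ^ (m * p ^ k)) := by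
  have h1 : (p : MvPolynomial σ ℤ) ∣ L ^ p - expand p L := by
    have := C_dvd_pow_prime_sub_expand L hp
    rwa [map_natCast] at this
  have h2 : ((p : MvPolynomial σ ℤ) ^ (k + 1)) ∣ L ^ p ^ (k + 1) - expand p (L ^ p ^ k) := by
    have := dvd_sub_pow_of_dvd_sub h1 k
    rwa [← pow_mul, ← map_pow, ← pow_succ'] at this
  have h3 := sub_dvd_pow_sub_pow (L ^ p ^ (k + 1)) (expand p (L ^ p ^ k)) m
  rw [← pow_mul, ← map_pow, ← pow_mul, mul_comm (p ^ (k + 1)) m, mul_comm (p ^ k) m] at h3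
  exact dvd_trans h2 h3

/-- **Gauss congruences for the coefficient sequence `u n = [x^{n·d}] Lⁿ`** of any `L : MvPolynomial σ ℤ` at any
exponent vector `d` (for `d` inside the Newton polytope this is the constant-term sequence of the Laurent
polynomial `L / x^d`): `pʳ ∣ u(m pʳ) − u(m pʳ⁻¹)` for every prime `p` and all `m r : ℕ` (trivial for `r = 0`). -/
theorem coeff_smul_pow_gauss (L : MvPolynomial σ ℤ) (d : σ →₀ ℕ) {p : ℕ} (hp : p.Prime) (m r : ℕ) :
    ((p : ℤ) ^ r) ∣ coeff ((m * p ^ r) • d) (L ^ (m * p ^ r)) -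
      coeff ((m * p ^ (r - 1)) • d) (L ^ (m * p ^ (r - 1))) := by
  rcases r with _ | k
  · simp
  · simp only [Nat.add_sub_cancel]
    have h := natCast_pow_dvd_pow_sub_expand_pow L hp m k
    rw [show ((p : MvPolynomial σ ℤ) ^ (k + 1)) = C ((p : ℤ) ^ (k + 1)) by rw [C_pow, map_natCast],
      C_dvd_iff_dvd_coeff] at h
    have e : coeff ((m * p ^ (k + 1)) • d) (expand p (L ^ (m * p ^ k))) =
        coeff ((m * p ^ k) • d) (L ^ (m * p ^ k)) := by
      rw [show (m * p ^ (k + 1)) • d = p • ((m * p ^ k) • d) by rw [smul_smul]; congr 1; ring,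
        coeff_expand_smul p hp.ne_zero]
    have hc := h ((m * p ^ (k + 1)) • d)
    rwa [coeff_sub, e] at hc

/-- Any integer sequence identified with a coefficient sequence `[x^{n·d}] Lⁿ` satisfies the Gauss congruences for
every prime. -/
theorem gauss_of_eq_coeff_smul_pow (u : ℕ → ℤ) (L : MvPolynomial σ ℤ) (d : σ →₀ ℕ)
    (hu : ∀ n, u n = coeff (n • d) (L ^ n)) {p : ℕ} (hp : p.Prime) (m r : ℕ) :
    ((p : ℤ) ^ r) ∣ u (m * p ^ r) - u (m * p ^ (r - 1)) := by
  rw [hu, hu]; exact coeff_smul_pow_gauss L d hp m r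

/-- The case `m = 1, r = 1`: `u p ≡ u 1 (mod p)`. -/
theorem gauss_prime_of_eq_coeff_smul_pow (u : ℕ → ℤ) (L : MvPolynomial σ ℤ) (d : σ →₀ ℕ)
    (hu : ∀ n, u n = coeff (n • d) (L ^ n)) {p : ℕ} (hp : p.Prime) : (p : ℤ) ∣ u p - u 1 := by
  simpa using gauss_of_eq_coeff_smul_pow u L d hu hp 1 1

end GaussCT

/-! ## The Brown–Zudilin family: torus periods along rays, and Zudilin's `Qₙ` -/

/-- The gap monomial `g^{B(a)}` of the dual constant term, as an exponent vector on the six gaps. -/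
def gapMonomial (a : Fin 8 → ℤ) : Fin 6 →₀ ℕ := Finsupp.equivFunOnFinite.symm (gapExp a)

/-- Along a ray of the cone the dual constant term is a coefficient sequence of ONE polynomial:
`dualConstantTerm (n·a) = [g^{n·B(a)}] (dualSpanProd A(a))ⁿ` (`A, B ≥ 0`). -/
theorem dualConstantTerm_ray_eq_coeff (a : Fin 8 → ℤ) (hA : ∀ i, 0 ≤ bzNum a i) (hB : ∀ i, 0 ≤ bzDen a i)
    (n : ℕ) : dualConstantTerm (fun i => (n : ℤ) * a i) =
      coeff (n • gapMonomial a) (dualSpanProd (numExp a) ^ n) := by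
  have e : dualConstantTerm (fun i => (n : ℤ) * a i) =
      coeff (Finsupp.equivFunOnFinite.symm (gapExp fun i => (n : ℤ) * a i))
        (dualSpanProd (numExp fun i => (n : ℤ) * a i)) := rfl
  rw [e, numExp_smul n hA, gapExp_smul n hB, DualCT.dualSpanProd_smul]
  congr 1
  ext w
  simp [gapMonomial]

/-- **Gauss congruences for the torus periods along every ray of the cone (UNCONDITIONAL):**
`pʳ ∣ J((m pʳ)·a) − J((m pʳ⁻¹)·a)` for every prime `p`, all `m, r`, every `a` with `A(a), B(a) ≥ 0`,
where `J(a) = dualConstantTerm a`. -/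
theorem dualConstantTerm_ray_gauss (a : Fin 8 → ℤ) (hA : ∀ i, 0 ≤ bzNum a i) (hB : ∀ i, 0 ≤ bzDen a i)
    {p : ℕ} (hp : p.Prime) (m r : ℕ) :
    ((p : ℤ) ^ r) ∣ dualConstantTerm (fun i => ((m * p ^ r : ℕ) : ℤ) * a i) -
      dualConstantTerm (fun i => ((m * p ^ (r - 1) : ℕ) : ℤ) * a i) :=
  GaussCT.gauss_of_eq_coeff_smul_pow (fun n => dualConstantTerm fun i => (n : ℤ) * a i)
    (dualSpanProd (numExp a)) (gapMonomial a) (dualConstantTerm_ray_eq_coeff a hA hB) hp m r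

/-- On the diagonal: `dualConstantTerm (n·1⁸) = [g^{n·1}] (dualSpanProd 1)ⁿ`. -/
theorem dualConstantTerm_diag_eq_coeff (n : ℕ) :
    dualConstantTerm (SymRay.aDiag n) =
      coeff (n • gapMonomial fun _ => 1) (dualSpanProd (numExp fun _ => 1) ^ n) := by
  have e : SymRay.aDiag n = fun i => (n : ℤ) * (fun _ : Fin 8 => (1 : ℤ)) i := by
    funext i; simp [SymRay.aDiag]
  rw [e]
  refine dualConstantTerm_ray_eq_coeff (fun _ => 1) ?_ ?_ n
  · intro i; rw [bzNum_const]; norm_num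
  · intro i; rw [bzDen_const]; norm_num

/-- **Gauss congruences for Zudilin's leading coefficients (UNCONDITIONAL):** for every prime `p` and all
`m r : ℕ`, `pʳ ∣ Q(m pʳ) − Q(m pʳ⁻¹)`, where `Q n` is [BrownZudilin2022, eq. (7)] (`1, 21, 2989, 714549, …`).
From the generic `GaussCT.coeff_smul_pow_gauss` and the tree's D-exact-on-the-diagonal identity
`DualCT.dualConstantTerm_diag_eq_Q` (`dualConstantTerm (n·1⁸) = Q n`).  The `mod p^{3r}` strengthening
(`p ≥ 5`) is [cite: MccarthyOsburnStraub2018, Conjecture 1.3] for this family and is NOT claimed. -/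
theorem Q_gauss {p : ℕ} (hp : p.Prime) (m r : ℕ) :
    ((p : ℤ) ^ r) ∣ (BrownZudilin2022.Q (m * p ^ r) : ℤ) - BrownZudilin2022.Q (m * p ^ (r - 1)) :=
  GaussCT.gauss_of_eq_coeff_smul_pow (fun n => (BrownZudilin2022.Q n : ℤ)) _ _
    (fun n => by rw [← DualCT.dualConstantTerm_diag_eq_Q, dualConstantTerm_diag_eq_coeff]) hp m r

/-- In particular `Q p ≡ Q 1 = 21 (mod p)` for every prime `p`. -/
theorem Q_prime_sub_21 {p : ℕ} (hp : p.Prime) : (p : ℤ) ∣ (BrownZudilin2022.Q p : ℤ) - 21 := by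
  have h := Q_gauss hp 1 1
  simp only [pow_one, one_mul, pow_zero, Nat.sub_self] at h
  have h1 : BrownZudilin2022.Q 1 = 21 := by decide
  rw [h1] at h
  exact_mod_cast h

/-- Kernel cross-check of the smallest cases: `Q 2 − Q 1 = 2968 = 2³·7·53` and `Q 3 − Q 1 = 714528 = 2⁵·3³·827`. -/
theorem Q_gauss_small : (BrownZudilin2022.Q 2 : ℤ) - BrownZudilin2022.Q 1 = 2 ^ 3 * 7 * 53 ∧
    (BrownZudilin2022.Q 3 : ℤ) - BrownZudilin2022.Q 1 = 2 ^ 5 * 3 ^ 3 * 827 := by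
  decide

/-- **CONDITIONAL on D-exact** (`LeadingCoeffIsDualConstantTerm`, `Families/DualConstantTerm`; NOT proved beyond the
diagonal and kernel instances): along every ray of the cone, `n ↦ |Q(n·a)|` satisfies the Gauss congruences for
every prime. -/
theorem abs_QOf_ray_gauss_of_conjDexact (hD : LeadingCoeffIsDualConstantTerm) (a : Fin 8 → ℤ)
    (hA : ∀ i, 0 ≤ bzNum a i) (hB : ∀ i, 0 ≤ bzDen a i) {p : ℕ} (hp : p.Prime) (m r : ℕ) :
    ((p : ℤ) ^ r) ∣ |BrownZudilin2022.QOf fun i => ((m * p ^ r : ℕ) : ℤ) * a i| -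
      |BrownZudilin2022.QOf fun i => ((m * p ^ (r - 1) : ℕ) : ℤ) * a i| := by
  have hA' : ∀ n : ℕ, ∀ i, 0 ≤ bzNum (fun i => (n : ℤ) * a i) i := by
    intro n i; rw [bzNum_smul]; exact mul_nonneg (by positivity) (hA i)
  have hB' : ∀ n : ℕ, ∀ i, 0 ≤ bzDen (fun i => (n : ℤ) * a i) i := by
    intro n i; rw [bzDen_smul]; exact mul_nonneg (by positivity) (hB i)
  rw [hD _ (hA' _) (hB' _), hD _ (hA' _) (hB' _)]
  exact dualConstantTerm_ray_gauss a hA hB hp m r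

end Summit.KontsevichZagierPeriods.Zeta5Search.Families.Cellular
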